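import Literature.AlgebraicGeometry.Modules.ProjectiveFamilyTwistPushforward
import Literature.AlgebraicGeometry.Modules.SerreTwistHyperplaneClass
import Literature.AlgebraicGeometry.AbelianVarieties.LineBundleTensorPower
import Literature.AlgebraicGeometry.Morphisms.UpperSemicontinuityH0ZariskiLocal
import HarnessLib

/-!
# Hilbert-letter transport: the letters of a family `Z ⊆ 𝐏(ι; T)` at a field point are read on ANY model of `𝒪_Z(e)|`, and `𝒪_Z(e) ≅ N^{⊗e}`
# as soon as `𝒪_Z(1) ≅ N`

Layer `Literature/AlgebraicGeometry/Modules`, namespace `Literature.AlgebraicGeometry.Modules.SerreTwist`.  THEOREMS ONLY (no definition, no named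
fact, no instance, no notation, no `sorry`).  Cell `hodgecm-mathlib` (D-0151), P6 «MOD programme», organ «stub_ILET» FILE A (generic, skeleton-
independent; LEAD F0P6-plan (g2) DEAL 2026-09-01 23:02:38Z; spec A-p14 (g34) SP3-a2 census 485f21e1 §3 row `stub_ILET`; B-p10 (g29)): the
«letter transport» the Hom-scheme pieces need, made public and generic (cf. the private `fieldPoint_of_baseChange₂` of ★
`Motives/HomSchemePieceData`).  The LETTERS of an embedded family `i : Z ⟶ 𝐏(ι; T)` at a field point `x : Spec K → T` (any cartesian
presentation `k : X₀ → Z`, `f₀ : X₀ → Spec K`) are the pair «`Ext¹(𝒪_{X₀}, k^*𝒪_Z(e)) = 0`, `dim_K Γ(X₀, k^*𝒪_Z(e))`» (★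
`FlatProjectiveFamilyHilbertPolynomialLocallyConstantScheme`, ★ `HomSchemePieceData`), `𝒪_Z(e) := twistMod (i ≫ pr₂) 𝒪_Z e` the Serre twist
along `Z → 𝐏ⁿ_ℤ`.  Consumer: ILET (`AbelianSchemes/PolarizedGraphFamilyLetters`): a graph family whose `𝒪(1)` is `L^Δ(λ)^{⊗6}|` has the
letters of `(A_t, L^Δ(λ)^{⊗6e}|)`.  Count-neutral: HC_CM is proved only modulo the printed citations until rung 0 closes.

* §1 **`detClass_twistMod_unitModule_eq_pow`** — `[𝒪_X(e)] = [𝒪_X(1)]^e` in `Ȟ¹(X, 𝒪^×)` for ANY `φ : X → 𝐏ʳ_A` (★ `detClass_serreTwist_eq_pow`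
  through `𝒪_X(e) = 𝒪_X(−e)^∨`, ★ `sheafHomTwistIso`, ★ `detClass_dual`); **`nonempty_twistMod_unitModule_iso_tensorPow_of_iso`** —
  `𝒪_X(1) ≅ N` ⇒ `𝒪_X(e) ≅ N^{⊗e}` (rank-one modules with equal classes, ★ `nonempty_iso_iff_detClass_eq`); the pulled-back form
  `k^*𝒪_X(e) ≅ (k^*N)^{⊗e}` (★ `nonempty_pullback_tensorPow_iso`).
* §2 **`subsingleton_ext_iff_of_iso'`**, **`letters_iff_of_iso`** — the two letters transfer along an isomorphism of the modules read on a
  common fibre presentation (★ `subsingleton_ext_of_iso`-pattern, ★ `finrank_secMod_eq_of_iso`).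
* §3 **`letters_twistMod_iff_of_twistMod_one_iso`** — THE TRANSPORT: for `i : Z ⟶ 𝐏(ι; T)` and `𝒪_Z(1) ≅ N` (`N` of rank one), at every
  field-point presentation `(k, f₀)` and every `e`: `Ext¹(𝒪, k^*𝒪_Z(e)) = 0 ↔ Ext¹(𝒪, (k^*N)^{⊗e}) = 0` and
  `dim_K Γ(k^*𝒪_Z(e)) = dim_K Γ((k^*N)^{⊗e})`.

## References
* [Hartshorne1977] R. Hartshorne, *Algebraic Geometry* (1977), II Prop. 5.12 (b)(c) (p. 117), II Ex. 5.16 (e), Ex. 6.11, II Thm. 7.1 (p. 150),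
  III Thm. 9.9 (p. 261), III Ex. 4.5.
* [MumfordFogartyKirwan1994] D. Mumford, J. Fogarty, F. Kirwan, *Geometric Invariant Theory*, 3rd ed. (1994), Ch. 0 §5 (c) (p. 23).
* [GortzWedhorn2020] U. Görtz, T. Wedhorn, *Algebraic Geometry I*, 2nd ed. (2020), Section (4.7), (13.8).
-/

noncomputable section

-- `TopCat.Presheaf`/`Scheme.Modules` bookkeeping (as in ★ `Modules/ProjectiveFamilyTwistPushforward`).
set_option backward.isDefEq.respectTransparency false

universe w u

open CategoryTheory CategoryTheory.Limits CategoryTheory.Abelian AlgebraicGeometry TopologicalSpace Opposite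

namespace Literature.AlgebraicGeometry.Modules

namespace SerreTwist

open Literature.AlgebraicGeometry.Morphisms Literature.AlgebraicGeometry.Morphisms.ProjCech Literature.AlgebraicGeometry.Motives

/-! ## §1 `𝒪_X(e) ≅ 𝒪_X(1)^{⊗e}` for any morphism to `𝐏ʳ_A` -/

section TwistPow

variable {A : Type u} [CommRing A] {r : ℕ} {X : Scheme.{u}} (φ : X ⟶ PP A r)

/-- **`[𝒪_X(e)] = [𝒪_X(1)]^e` in `Ȟ¹(X, 𝒪_X^×)`** for ANY `φ : X → 𝐏ʳ_A`: `𝒪_X(e) = 𝓗om(𝒪_X(−e), 𝒪_X) = 𝒪_X(−e)^∨` (★ `sheafHomTwistIso`),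
`[𝒪_X(−e)^∨] = [𝒪_X(−e)]⁻¹` (★ `detClass_dual`) and `[𝒪_X(−e)] = [𝒪_X(−1)]^e` (★ `detClass_serreTwist_eq_pow`).
[cite: Hartshorne1977, II Prop. 5.12 (b) (p. 117) and II Ex. 5.16 (e)] -/
theorem detClass_twistMod_unitModule_eq_pow (e : ℕ) :
    detClass (isFiniteLocallyFree_twistMod_unitModule φ e) = detClass (isFiniteLocallyFree_twistMod_unitModule φ 1) ^ e := by
  have h : ∀ n : ℕ, detClass (isFiniteLocallyFree_twistMod_unitModule φ n) = (detClass (isFiniteLocallyFree_serreTwist φ n))⁻¹ :=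
    fun n ↦ by
      rw [← detClass_dual (isFiniteLocallyFree_serreTwist φ n)]
      exact detClass_eq_of_iso (sheafHomTwistIso φ (unitModule X) n).symm _ _
  rw [h e, h 1, detClass_serreTwist_eq_pow φ e, inv_pow]

/-- **`𝒪_X(1) ≅ N` ⇒ `𝒪_X(e) ≅ N^{⊗e}`** (`N` of rank one; rank-one modules with equal classes in `Ȟ¹(X, 𝒪_X^×)` are isomorphic, ★
`nonempty_iso_iff_detClass_eq`, ★ `detClass_tensorPow`). [cite: Hartshorne1977, II Prop. 5.12 (b) (p. 117) and III Ex. 4.5] -/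
theorem nonempty_twistMod_unitModule_iso_tensorPow_of_iso {N : X.Modules} (hN : HasRank N 1)
    (ψ : twistMod φ (unitModule X) 1 ≅ N) (e : ℕ) : Nonempty (twistMod φ (unitModule X) e ≅ tensorPow N e) := by
  have hN₁ : IsFiniteLocallyFree N := HasRank.isFiniteLocallyFree' hN
  refine (nonempty_iso_iff_detClass_eq (hasRank_twistMod_unitModule φ e) (hasRank_tensorPow_one hN e)
    (isFiniteLocallyFree_twistMod_unitModule φ e) (isFiniteLocallyFree_tensorPow hN₁ e)).2 ?_
  rw [detClass_twistMod_unitModule_eq_pow φ e, detClass_tensorPow hN hN₁ e,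
    detClass_eq_of_iso ψ (isFiniteLocallyFree_twistMod_unitModule φ 1) hN₁]

/-- **Pulled back: `k^*𝒪_X(e) ≅ (k^*N)^{⊗e}`** whenever `𝒪_X(1) ≅ N` (★ `nonempty_pullback_tensorPow_iso`).
[cite: Hartshorne1977, II Prop. 5.12 (c) (p. 117) and II Ex. 6.8 (a)] -/
theorem nonempty_pullback_twistMod_unitModule_iso_tensorPow_of_iso {N : X.Modules} (hN : HasRank N 1)
    (ψ : twistMod φ (unitModule X) 1 ≅ N) {Y : Scheme.{u}} (k : Y ⟶ X) (e : ℕ) :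
    Nonempty ((Scheme.Modules.pullback k).obj (twistMod φ (unitModule X) e) ≅ tensorPow ((Scheme.Modules.pullback k).obj N) e) := by
  obtain ⟨e₁⟩ := nonempty_twistMod_unitModule_iso_tensorPow_of_iso φ hN ψ e
  obtain ⟨e₂⟩ := nonempty_pullback_tensorPow_iso k hN e
  exact ⟨(Scheme.Modules.pullback k).mapIso e₁ ≪≫ e₂⟩

end TwistPow

/-! ## §2 Letters transfer along an isomorphism of modules on a common fibre presentation -/

section Iso

variable {X₀ : Scheme.{u}} {M₁ M₂ : X₀.Modules}

/-- `Ext¹`-vanishing (any degree) is invariant under isomorphism of the second argument (★ `subsingleton_ext_of_iso` pattern).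
[cite: Hartshorne1977, III Ex. 4.5] -/
theorem subsingleton_ext_iff_of_iso' [HasExt.{w} X₀.Modules] (ψ : M₁ ≅ M₂) (P : X₀.Modules) (n : ℕ) :
    Subsingleton (Ext.{w} P M₁ n) ↔ Subsingleton (Ext.{w} P M₂ n) := by
  have key : ∀ {Y Y' : X₀.Modules} (e : Y ≅ Y'), Subsingleton (Ext.{w} P Y' n) → Subsingleton (Ext.{w} P Y n) := by
    intro Y Y' e h
    refine subsingleton_of_forall_eq 0 fun x => ?_
    have hx : x = (x.comp (Ext.mk₀ e.hom) (add_zero n)).comp (Ext.mk₀ e.inv) (add_zero n) := by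
      rw [Ext.comp_assoc_of_second_deg_zero, Ext.mk₀_comp_mk₀, e.hom_inv_id, Ext.comp_mk₀_id]
    rw [hx, Subsingleton.elim (x.comp (Ext.mk₀ e.hom) (add_zero n)) 0, Ext.zero_comp]
  exact ⟨key ψ.symm, key ψ⟩

/-- **THE TWO LETTERS TRANSFER ALONG `ψ : M₁ ≅ M₂`** on a scheme `X₀` over a ring of scalars `ρ : R → Γ(X₀, 𝒪)` (a field point
`f₀ : X₀ → Spec K` reads `ρ := f₀♯`): `Ext¹(P, M₁) = 0 ↔ Ext¹(P, M₂) = 0` and `dim_R Γ(X₀, M₁) = dim_R Γ(X₀, M₂)` (★ `finrank_secMod_eq_of_iso`).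
[cite: Hartshorne1977, III Thm. 9.9 (p. 261) and III Ex. 4.5] [cite: GortzWedhorn2020, Section (4.7)] -/
theorem letters_iff_of_iso [HasExt.{w} X₀.Modules] (ψ : M₁ ≅ M₂) (P : X₀.Modules) (n : ℕ) {R : Type u} [CommRing R]
    (ρ : R →+* Γ(X₀, ⊤)) :
    (Subsingleton (Ext.{w} P M₁ n) ↔ Subsingleton (Ext.{w} P M₂ n)) ∧
      Module.finrank R (SecMod M₁ ρ ⊤) = Module.finrank R (SecMod M₂ ρ ⊤) :=
  ⟨subsingleton_ext_iff_of_iso' ψ P n, finrank_secMod_eq_of_iso ρ ψ⟩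

end Iso

/-! ## §3 The letters of a family whose `𝒪(1)` is known -/

section Family

variable {ι : Type} {T Z : Scheme.{0}} (i : Z ⟶ Morphisms.projectiveSpace ι T) {N : Z.Modules} (hN : HasRank N 1)
  (ψ : twistMod (i ≫ pullback.snd (terminal.from T) (terminal.from (Morphisms.projectiveSpaceInt ι))) (unitModule Z) 1 ≅ N)
  {K : Type} [CommRing K] {X₀ : Scheme.{0}} (k : X₀ ⟶ Z) (f₀ : X₀ ⟶ Spec (.of K))

include hN ψ in
/-- **HILBERT-LETTER TRANSPORT.**  `i : Z ⟶ 𝐏(ι; T)` ANY family (no flatness, no closed immersion needed here), `𝒪_Z(1) := twistMod (i ≫ pr₂) 𝒪_Z 1`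
its Serre twist along `Z → 𝐏ⁿ_ℤ`, `N` a rank-one `𝒪_Z`-module with `𝒪_Z(1) ≅ N`, and `(k : X₀ → Z, f₀ : X₀ → Spec K)` ANY pair (a fibre
presentation at a field point, in the consumers).  THEN for every `e`: `Ext¹(𝒪_{X₀}, k^*𝒪_Z(e)) = 0 ↔ Ext¹(𝒪_{X₀}, (k^*N)^{⊗e}) = 0` and
`dim_K Γ(X₀, k^*𝒪_Z(e)) = dim_K Γ(X₀, (k^*N)^{⊗e})` — the letters of the family at that point are the letters of `(X₀, (k^*N)^{⊗e})`
(§1 + §2).  This is the public, generic form of the letter transport inside ★ `HomSchemePieceData` ([MumfordFogartyKirwan1994] Ch. 0 §5 (c)).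
[cite: Hartshorne1977, II Thm. 7.1 (p. 150) and III Thm. 9.9 (p. 261)] [cite: MumfordFogartyKirwan1994, Ch. 0 §5 (c) (p. 23)] -/
theorem letters_twistMod_iff_of_twistMod_one_iso (e : ℕ) :
    (Subsingleton (Ext.{1} (unitModule X₀) ((Scheme.Modules.pullback k).obj
        (twistMod (i ≫ pullback.snd (terminal.from T) (terminal.from (Morphisms.projectiveSpaceInt ι))) (unitModule Z) e)) 1) ↔
      Subsingleton (Ext.{1} (unitModule X₀) (tensorPow ((Scheme.Modules.pullback k).obj N) e) 1)) ∧
    Module.finrank Γ(Spec (.of K), ⊤) (SecMod ((Scheme.Modules.pullback k).obj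
        (twistMod (i ≫ pullback.snd (terminal.from T) (terminal.from (Morphisms.projectiveSpaceInt ι))) (unitModule Z) e))
        f₀.appTop.hom ⊤) =
      Module.finrank Γ(Spec (.of K), ⊤) (SecMod (tensorPow ((Scheme.Modules.pullback k).obj N) e) f₀.appTop.hom ⊤) := by
  obtain ⟨χ⟩ := nonempty_pullback_twistMod_unitModule_iso_tensorPow_of_iso
    (i ≫ pullback.snd (terminal.from T) (terminal.from (Morphisms.projectiveSpaceInt ι))) hN ψ k e
  exact letters_iff_of_iso χ (unitModule X₀) 1 f₀.appTop.hom

end Family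

end SerreTwist

end Literature.AlgebraicGeometry.Modules

end
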